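import Mathlib
import HarnessLib
import Summits.AtomisticToContinuum.BoseEinsteinCondensation.Theorems.HealingPivotCascadeCascadeEngine
import Summits.AtomisticToContinuum.BoseEinsteinCondensation.Theorems.ScaleConvexityFractionCalculus
import Summits.AtomisticToContinuum.BoseEinsteinCondensation.Theses.NumberPhaseSandwich
import Summits.AtomisticToContinuum.BoseEinsteinCondensation.Theorems.NumberPhaseSandwichSandwichAlgebra

/-!
# NumberPhaseSandwich — THE SANDWICH ENGINE (item `SandwichEngine`, stmt-AtomisticToContinuum-32641)

Port of the kernel-checked engine sections of the node file `NodeNumberPhaseSandwich.lean` (decomp-a2c lens-6 g10,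
0 sorry) against the gate-written route file `Theses/NumberPhaseSandwich.lean`: per-density shorthands `SatAt` /
`FlucAt` / `WallAt` / `BookAt` / `DomAbsAt` with their definitional links to the route items, the sandwich algebra
(`card_filter_sib_le`, `sum_sum_filter_add_le`, `level_law_abstract`, `domAbsAt_of_pieces`: sibling counting ≤ 8,
interior/wall split, ENNReal division), the three-phase real cascade (`cap_steps`, `law_steps`), the absolute-law cascade
engine `hasGroundStateBEC_of_absCascade`, and `sandwichEngine : …Theses.NumberPhaseSandwich.SandwichEngine` BY NAME.
-/

noncomputable section

namespace Summit.AtomisticToContinuum.BoseEinsteinCondensation.Theorems.NumberPhaseSandwichSandwichEngine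

open scoped BigOperators Topology Classical MeasureTheory ComplexConjugate ENNReal NNReal
open Filter Set MeasureTheory
open Summit.AtomisticToContinuum.BoseEinsteinCondensation.Theorems.ScaleConvexityFractionCalculus
  (IsModeOn mass occupation_le_mass)
open Summit.AtomisticToContinuum.BoseEinsteinCondensation.Theorems.HealingPivotCascadeEngineCore
  (subSum subMode_isModeOn subSum_le_card subSum_ne_top subSum_zero_le_maxOccupation)
open Summit.AtomisticToContinuum.BoseEinsteinCondensation.Theorems.HealingPivotCascadeCascadeEngine
  (EscapeAt FloorAt CapAt DomAt exists_pivot escapeAt_of_hasGroundStateBEC capAt_of_hasGroundStateBEC)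
open Summit.AtomisticToContinuum.BoseEinsteinCondensation.Theses.NumberPhaseSandwich
open Summit.AtomisticToContinuum.BoseEinsteinCondensation.Theorems.NumberPhaseSandwichSandwichAlgebra

/-! ## Per-density shorthands (NOT items) and their definitional link to the items -/

/-! ## The engine: floor + cap + absolute two-sided law ⇒ BEC at one density -/

section Engine
open Literature.MathematicalPhysics.QuantumManyBody.BoseGas

/-- **THE ABSOLUTE-LAW CASCADE ENGINE** (kernel): floor at the healing pivot + retention cap + the absolute
two-sided law at one density ⇒ `HasGroundStateBEC v ρ`. -/
theorem hasGroundStateBEC_of_absCascade {v : ℝ → ENNReal} {ρ : ℝ} (hρ : 0 < ρ) (hF : FloorAt v ρ)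
    (hC : CapAt v ρ) (hD : DomAbsAt v ρ) : HasGroundStateBEC v ρ := by
  obtain ⟨x, hx0, hx1, c₁, hc₁, HC⟩ := hC
  obtain ⟨A₁, hA₁, q₁, hq₁0, hq₁1, A₂, hA₂, q₂, hq₂0, hq₂1, c₂, hc₂, HD⟩ := hD
  have hx' : 0 < 1 - x := sub_pos.2 hx1
  have h1q₁ : 0 < 1 - q₁ := sub_pos.2 hq₁1
  have h1q₂ : 0 < 1 - q₂ := sub_pos.2 hq₂1
  -- pivot-side bad count `i₀`: `A₁ q₁^(i₀) ≤ (1 − q₁)/4`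
  obtain ⟨i₀, hi₀⟩ : ∃ i₀ : ℕ, A₁ * q₁ ^ i₀ ≤ (1 - q₁) / 4 := by
    obtain ⟨n, hn⟩ := exists_pow_lt_of_lt_one (show 0 < (1 - q₁) / (4 * A₁) by positivity) hq₁1
    refine ⟨n, ?_⟩
    calc A₁ * q₁ ^ n ≤ A₁ * ((1 - q₁) / (4 * A₁)) := (mul_lt_mul_of_pos_left hn hA₁).le
      _ = (1 - q₁) / 4 := by field_simp
  -- the middle running bound `θ₂` and the box-side bad count `k₀`: `A₂ q₂^(k₀+1) ≤ (1 − q₂) θ₂ / 4`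
  set θ₂ : ℝ := 7 / 8 * (1 - x) ^ i₀ / 2 with hθ₂_def
  have hθ₂ : 0 < θ₂ := by positivity
  obtain ⟨k₀, hk₀⟩ : ∃ k₀ : ℕ, A₂ * q₂ ^ (k₀ + 1) ≤ (1 - q₂) * θ₂ / 4 := by
    obtain ⟨n, hn⟩ := exists_pow_lt_of_lt_one (show 0 < (1 - q₂) * θ₂ / (4 * A₂) by positivity) hq₂1
    refine ⟨n, ?_⟩
    calc A₂ * q₂ ^ (n + 1) ≤ A₂ * q₂ ^ n := by
          rw [pow_succ]; exact mul_le_mul_of_nonneg_left (mul_le_of_le_one_right (by positivity) hq₂1.le) hA₂.le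
      _ ≤ A₂ * ((1 - q₂) * θ₂ / (4 * A₂)) := (mul_lt_mul_of_pos_left hn hA₂).le
      _ = (1 - q₂) * θ₂ / 4 := by field_simp
  -- the final constant
  set cf : ℝ := θ₂ * (1 - x) ^ k₀ with hcf_def
  have hcf : 0 < cf := by positivity
  have HCθ := HC cf hcf
  set c : ℝ := min (min c₁ c₂) cf with hc_def
  have hc : 0 < c := lt_min (lt_min hc₁ hc₂) hcf
  refine ⟨c, hc, ?_⟩
  have hLev : ∀ᶠ N : ℕ in atTop, 1 / Real.sqrt ρ ≤ sideLength ρ N :=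
    (tendsto_sideLength_atTop hρ).eventually_ge_atTop _
  filter_upwards [hF, HCθ, HD, hLev, eventually_gt_atTop 0] with N hFN hCN hDN hLN hNpos
  obtain ⟨δ₁, hδ₁, H₁⟩ := hCN
  obtain ⟨δ₂, hδ₂, H₂⟩ := hDN
  set L := sideLength ρ N with hLdef
  have hL : 0 < L := sideLength_pos_of_pos hρ hNpos
  have hNr : (0 : ℝ) < N := by exact_mod_cast hNpos
  refine le_condensateNumber v (δ := min (min δ₁ δ₂) 1) (lt_min (lt_min hδ₁ hδ₂) one_pos) fun Ψ hΨ => ?_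
  have hΨ₁ : energy v Ψ ≤ groundStateEnergy v N L + δ₁ :=
    hΨ.trans (add_le_add le_rfl ((min_le_left _ _).trans (min_le_left _ _)))
  have hΨ₂ : energy v Ψ ≤ groundStateEnergy v N L + δ₂ :=
    hΨ.trans (add_le_add le_rfl ((min_le_left _ _).trans (min_le_right _ _)))
  have hΨ₃ : energy v Ψ ≤ groundStateEnergy v N L + 1 := hΨ.trans (add_le_add le_rfl (min_le_right _ _))
  have finish : ∀ c' : ℝ, c ≤ c' → ENNReal.ofReal (c' * N) ≤ maxOccupation N Ψ.ψ →
      ENNReal.ofReal (c * N) ≤ maxOccupation N Ψ.ψ := fun c' hcc' h =>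
    (ENNReal.ofReal_le_ofReal (mul_le_mul_of_nonneg_right hcc' hNr.le)).trans h
  rcases H₁ Ψ hΨ₁ with hesc | hcap
  · exact finish c₁ ((min_le_left _ _).trans (min_le_left _ _)) hesc
  rcases H₂ Ψ hΨ₂ with hesc | hdom
  · exact finish c₂ ((min_le_left _ _).trans (min_le_right _ _)) hesc
  -- the pivot level and the floor there
  obtain ⟨K, hK1, hK2⟩ := exists_pivot hρ hLN
  have hfloor := hFN Ψ hΨ₃ K hK1 hK2
  -- the real profile `a k := S_k.toReal / N`
  set S : ℕ → ENNReal := fun k => subSum N L k Ψ.ψ with hSdef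
  have hS_ne : ∀ k, S k ≠ ⊤ := fun k => subSum_ne_top hL k Ψ
  set a : ℕ → ℝ := fun k => (S k).toReal / N with hadef
  have haS : ∀ k, (S k).toReal = a k * N := fun k => by
    simp only [hadef]; field_simp
  -- floor in real form
  have hK : 7 / 8 ≤ a K := by
    have h := (ENNReal.ofReal_le_iff_le_toReal (hS_ne K)).1 hfloor
    rw [haS] at h
    have : 7 / 8 * (N : ℝ) ≤ a K * N := by linarith
    exact le_of_mul_le_mul_right this hNr
  -- cap in real form
  have hcap' : ∀ k, 1 ≤ k → k ≤ K → cf ≤ a k → (1 - x) * a k ≤ a (k - 1) := by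
    intro k hk1 _ hθ
    have hθN : ENNReal.ofReal (cf * N) ≤ S k := by
      rw [ENNReal.ofReal_le_iff_le_toReal (hS_ne k), haS]
      exact mul_le_mul_of_nonneg_right hθ hNr.le
    have h := hcap k hk1 hθN
    have h' := ENNReal.toReal_mono (hS_ne (k - 1)) h
    rw [ENNReal.toReal_mul, ENNReal.toReal_ofReal hx'.le] at h'
    change (1 - x) * (S k).toReal ≤ (S (k - 1)).toReal at h'
    rw [haS, haS] at h'
    have : ((1 - x) * a k) * N ≤ a (k - 1) * N := by linarith
    exact le_of_mul_le_mul_right this hNr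
  -- the absolute law in real form: `a k − d k a k − w k ≤ a (k−1)`
  set d : ℕ → ℝ := fun k => A₁ * q₁ ^ (K - k) with hd_def
  set w : ℕ → ℝ := fun k => A₂ * q₂ ^ k with hw_def
  have hd0 : ∀ k, 0 ≤ d k := fun k => by positivity
  have hw0 : ∀ k, 0 ≤ w k := fun k => by positivity
  have hlaw' : ∀ k, 1 ≤ k → k ≤ K → a k - d k * a k - w k ≤ a (k - 1) := by
    intro k hk1 hkK
    have h := hdom K k hK1 hK2 hk1 hkK
    change S k ≤ S (k - 1) + ENNReal.ofReal (A₁ * q₁ ^ (K - k)) * S k + ENNReal.ofReal (A₂ * q₂ ^ k * N) at h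
    have hAq : 0 ≤ A₁ * q₁ ^ (K - k) := by positivity
    have hAw : 0 ≤ A₂ * q₂ ^ k * N := by positivity
    have hfin1 : ENNReal.ofReal (A₁ * q₁ ^ (K - k)) * S k ≠ ⊤ := ENNReal.mul_ne_top ENNReal.ofReal_ne_top (hS_ne _)
    have hfin : S (k - 1) + ENNReal.ofReal (A₁ * q₁ ^ (K - k)) * S k + ENNReal.ofReal (A₂ * q₂ ^ k * N) ≠ ⊤ :=
      ENNReal.add_ne_top.2 ⟨ENNReal.add_ne_top.2 ⟨hS_ne _, hfin1⟩, ENNReal.ofReal_ne_top⟩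
    have h' := ENNReal.toReal_mono hfin h
    rw [ENNReal.toReal_add (ENNReal.add_ne_top.2 ⟨hS_ne _, hfin1⟩) ENNReal.ofReal_ne_top,
      ENNReal.toReal_add (hS_ne _) hfin1, ENNReal.toReal_mul, ENNReal.toReal_ofReal hAq,
      ENNReal.toReal_ofReal hAw, haS, haS] at h'
    have : (a k - d k * a k - w k) * N ≤ a (k - 1) * N := by
      simp only [hd_def, hw_def]; nlinarith
    exact le_of_mul_le_mul_right this hNr
  -- THE THREE PHASES
  have hx1' : x ≤ 1 := hx1.le
  have hmain : cf ≤ a 0 := by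
    by_cases hsmall : K < i₀ + k₀
    · -- all cap steps
      have hθle : cf ≤ 7 / 8 * (1 - x) ^ K := by
        calc cf = 7 / 8 * (1 - x) ^ (i₀ + k₀) / 2 := by simp only [hcf_def, hθ₂_def]; ring
          _ ≤ 7 / 8 * (1 - x) ^ (i₀ + k₀) := by
              have : 0 ≤ 7 / 8 * (1 - x) ^ (i₀ + k₀) := by positivity
              linarith
          _ ≤ 7 / 8 * (1 - x) ^ K :=
              mul_le_mul_of_nonneg_left (pow_le_pow_of_le_one hx'.le (by linarith) (by omega)) (by norm_num)
      have h := cap_steps (b := 7 / 8) hx0.le hx1' (by norm_num) hcap' le_rfl hK K le_rfl hθle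
      simpa using hθle.trans h
    · replace hsmall : i₀ + k₀ ≤ K := not_lt.1 hsmall
      -- phase 1: i₀ cap steps from the pivot
      have hθ₁ : cf ≤ 7 / 8 * (1 - x) ^ i₀ := by
        calc cf ≤ θ₂ := by
              simp only [hcf_def]
              exact mul_le_of_le_one_right hθ₂.le (pow_le_one₀ hx'.le (by linarith))
          _ ≤ 7 / 8 * (1 - x) ^ i₀ := by
              simp only [hθ₂_def]
              have : 0 ≤ 7 / 8 * (1 - x) ^ i₀ := by positivity
              linarith
      have hph1 : 2 * θ₂ ≤ a (K - i₀) := by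
        have h := cap_steps (b := 7 / 8) hx0.le hx1' (by norm_num) hcap' le_rfl hK i₀ (by omega) hθ₁
        calc 2 * θ₂ = 7 / 8 * (1 - x) ^ i₀ := by simp only [hθ₂_def]; ring
          _ ≤ a (K - i₀) := h
      -- phase 2: guarded law steps from `K − i₀` down to `k₀`
      have hbudget : ∑ k ∈ Finset.Ioc k₀ (K - i₀), (d k + w k / θ₂) ≤ 1 / 2 := by
        rw [Finset.sum_add_distrib]
        have hb1 : ∑ k ∈ Finset.Ioc k₀ (K - i₀), d k ≤ 1 / 4 := by
          calc ∑ k ∈ Finset.Ioc k₀ (K - i₀), d k = A₁ * ∑ k ∈ Finset.Ioc k₀ (K - i₀), q₁ ^ (K - k) := by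
                rw [Finset.mul_sum]
            _ ≤ A₁ * (q₁ ^ (K - (K - i₀)) / (1 - q₁)) :=
                mul_le_mul_of_nonneg_left (sum_Ioc_pow_sub_le hq₁0.le hq₁1 (Nat.sub_le _ _)) hA₁.le
            _ = A₁ * q₁ ^ i₀ / (1 - q₁) := by
                rw [show K - (K - i₀) = i₀ by omega]; ring
            _ ≤ (1 - q₁) / 4 / (1 - q₁) := by gcongr
            _ = 1 / 4 := by field_simp
        have hb2 : ∑ k ∈ Finset.Ioc k₀ (K - i₀), w k / θ₂ ≤ 1 / 4 := by
          calc ∑ k ∈ Finset.Ioc k₀ (K - i₀), w k / θ₂ = A₂ / θ₂ * ∑ k ∈ Finset.Ioc k₀ (K - i₀), q₂ ^ k := by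
                rw [Finset.mul_sum]; exact Finset.sum_congr rfl fun k _ => by simp only [hw_def]; ring
            _ ≤ A₂ / θ₂ * (q₂ ^ (k₀ + 1) / (1 - q₂)) :=
                mul_le_mul_of_nonneg_left (sum_Ioc_pow_le hq₂0.le hq₂1 _ _) (by positivity)
            _ = A₂ * q₂ ^ (k₀ + 1) / (θ₂ * (1 - q₂)) := by field_simp
            _ ≤ (1 - q₂) * θ₂ / 4 / (θ₂ * (1 - q₂)) := by gcongr
            _ = 1 / 4 := by field_simp
        linarith
      have hph2 := law_steps (lo := k₀) (hi := K - i₀) hθ₂ hd0 hw0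
        (fun k hk1 hk2 _ => hlaw' k (by omega) (by omega)) hph1 hbudget (K - i₀ - k₀) le_rfl
      have hk₀le : θ₂ ≤ a k₀ := by
        have e : K - i₀ - (K - i₀ - k₀) = k₀ := by omega
        rw [e] at hph2
        have hs : ∑ k ∈ Finset.Ioc (K - i₀ - (K - i₀ - k₀)) (K - i₀), (d k + w k / θ₂) ≤ 1 / 2 := by
          rw [e]; exact hbudget
        nlinarith
      -- phase 3: k₀ cap steps at the top
      have hθ₃ : cf ≤ θ₂ * (1 - x) ^ k₀ := le_rfl
      have h := cap_steps (b := θ₂) hx0.le hx1' hθ₂.le hcap' (by omega) hk₀le k₀ le_rfl hθ₃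
      simpa [hcf_def] using h
  -- back to `ENNReal`: `S_0 ≥ cf N`, and `S_0 ≤ λ_max`
  have h0 : ENNReal.ofReal (cf * N) ≤ S 0 := by
    rw [ENNReal.ofReal_le_iff_le_toReal (hS_ne 0), haS]
    exact mul_le_mul_of_nonneg_right hmain hNr.le
  exact finish cf (min_le_right _ _) (h0.trans (subSum_zero_le_maxOccupation hL Ψ.ψ))

/-- **support item `SandwichEngine` (stmt-AtomisticToContinuum-32641) PROVED, BY NAME**: floor at the healing pivot,
retention cap, phase saturation, fluctuation floor, wall-layer mass and loss bookkeeping at one density imply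
`HasGroundStateBEC v ρ` (via `domAbsAt_of_pieces` and `hasGroundStateBEC_of_absCascade`). -/
theorem sandwichEngine :
    Summit.AtomisticToContinuum.BoseEinsteinCondensation.Theses.NumberPhaseSandwich.SandwichEngine := by
  rw [sandwichEngine_iff]
  intro v ρ hρ hF hC hS hFl hW hB
  exact hasGroundStateBEC_of_absCascade hρ hF hC (domAbsAt_of_pieces hρ hS hFl hW hB)

end Engine

end Summit.AtomisticToContinuum.BoseEinsteinCondensation.Theorems.NumberPhaseSandwichSandwichEngine

end
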